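import Mathlib
import Literature.MathematicalPhysics.StatisticalMechanics.BarlowStacking

/-!
# The arithmetic lemma of the essential-periodicity stub (stub `stub_essentialPeriodicityRat` of
# crux `HcpDiffractionRigidity`, item `stmt-AtomisticToContinuum-13166`, Aux file 4)

Pure arithmetic of the hcp template with `h² = q a²`, `q ∈ ℚ`:

* `hcp_dual_norm_sq` — every vector `k` of the dual `L*` of the hcp period lattice
  `ℤ(a,0,0) + ℤ(a/2, a√3/2, 0) + ℤ(0,0,2h)` has `12 · num(q) · a² |k|² ∈ ℤ`
  (`a k₀, a(k₀ + √3 k₁)/2, 2h k₂ ∈ ℤ`);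
* `exists_int_of_forall_not_admissible` — THE ARITHMETIC LEMMA. Let `M` be a `ℤ`-module of
  vectors with `D⟨u,v⟩ ∈ a²ℤ` (`u, v ∈ M`). The vectors `(D/a²) b`, `b ∈ M`, pair integrally with
  `M`, and `D₀ a² |(D/a²) b|² ∈ ℤ` (`D₀ = 12 num(q)`). Hence if `ξ + (D/a²) b` lies, for EVERY
  `b ∈ M`, in the Bragg set `{0} ∪ ⋃_{k ∈ L*} {|η| = |k|}`, then expanding
  `|ξ + (D/a²) b|² = |ξ|² + 2(D/a²)⟨ξ,b⟩ + |(D/a²) b|²` shows `2 D D₀ ⟨ξ, b⟩ ∈ ℤ` for all `b ∈ M`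
  (the factor `a²` cancels).

All `[folklore]`.
-/

noncomputable section

namespace Summit.AtomisticToContinuum.Crystallization.Theorems

namespace HcpRigiditySpectral

open scoped BigOperators Real RealInnerProductSpace
open Literature.MathematicalPhysics.StatisticalMechanics

/-! ## The dual of the hcp period lattice -/

/-- The three period vectors `(a,0,0)`, `(a/2, a√3/2, 0)`, `(0,0,2h)` (the latter written as in
`barlowPeriodVec`) belong to the hcp period lattice. [folklore] -/
theorem mem_hcp_lattice {a h : ℝ} (ha : a ≠ 0) (hh : h ≠ 0) :
    triangularVec₁ a ∈ (hcpPeriodicConfiguration ha hh).lattice ∧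
      triangularVec₂ a ∈ (hcpPeriodicConfiguration ha hh).lattice ∧
      (haggWindow alternatingHagg 0 2 : ℝ) • barlowOffset a + ((2 : ℕ) : ℝ) • layerNormal h ∈
        (hcpPeriodicConfiguration ha hh).lattice := by
  have hL : (hcpPeriodicConfiguration ha hh).lattice =
      barlowPeriodLattice alternatingHagg ha hh two_ne_zero := rfl
  have h1 := sum_smul_mem_barlowPeriodLattice alternatingHagg ha hh two_ne_zero 1 0 0
  have h2 := sum_smul_mem_barlowPeriodLattice alternatingHagg ha hh two_ne_zero 0 1 0
  have h3 := sum_smul_mem_barlowPeriodLattice alternatingHagg ha hh two_ne_zero 0 0 1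
  simp only [Int.cast_one, Int.cast_zero, one_smul, zero_smul, add_zero, zero_add] at h1 h2 h3
  rw [hL]
  exact ⟨h1, h2, h3⟩

/-- **Squared norms of hcp dual vectors.** If `h² = q a²` and `⟨k, g⟩ ∈ ℤ` for every `g` in the hcp
period lattice, then `12 · num(q) · a² |k|² ∈ ℤ`. [folklore] -/
theorem hcp_dual_norm_sq {a h : ℝ} (ha : a ≠ 0) (hh : h ≠ 0) {q : ℚ} (hq : h ^ 2 = (q : ℝ) * a ^ 2)
    {k : EuclideanSpace ℝ (Fin 3)}
    (hk : ∀ g ∈ (hcpPeriodicConfiguration ha hh).lattice, ∃ n : ℤ, ⟪k, g⟫ = (n : ℝ)) :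
    ∃ n : ℤ, 12 * (q.num : ℝ) * a ^ 2 * ‖k‖ ^ 2 = (n : ℝ) := by
  obtain ⟨hu, hv, ht⟩ := mem_hcp_lattice ha hh
  obtain ⟨n₀, hn₀⟩ := hk _ hu
  obtain ⟨n₁, hn₁⟩ := hk _ hv
  obtain ⟨n₂, hn₂⟩ := hk _ ht
  have hw0 : haggWindow alternatingHagg 0 2 = 0 := by rw [haggWindow_alternating]; decide
  have e₀ : a * k 0 = n₀ := by
    rw [← hn₀]; simp [triangularVec₁, PiLp.inner_apply, Fin.sum_univ_three]
  have e₁ : a / 2 * k 0 + a * √3 / 2 * k 1 = n₁ := by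
    rw [← hn₁]; simp [triangularVec₂, PiLp.inner_apply, Fin.sum_univ_three]
  have e₂ : 2 * h * k 2 = n₂ := by
    rw [← hn₂]; simp [hw0, layerNormal, PiLp.inner_apply, Fin.sum_univ_three]
  have hnorm : ‖k‖ ^ 2 = k 0 ^ 2 + k 1 ^ 2 + k 2 ^ 2 := by
    rw [EuclideanSpace.real_norm_sq_eq, Fin.sum_univ_three]
  have h3 : (√3 : ℝ) ^ 2 = 3 := Real.sq_sqrt (by norm_num)
  have hqn : (q : ℝ) * (q.den : ℝ) = (q.num : ℝ) := by exact_mod_cast Rat.mul_den_eq_num q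
  refine ⟨12 * q.num * n₀ ^ 2 + 4 * q.num * (2 * n₁ - n₀) ^ 2 + 3 * q.den * n₂ ^ 2, ?_⟩
  rw [hnorm]
  push_cast
  have e₁' : a * √3 * k 1 = 2 * n₁ - n₀ := by linear_combination 2 * e₁ - e₀
  linear_combination (12 * (q.num : ℝ) * (a * k 0 + n₀)) * e₀ +
    (4 * (q.num : ℝ) * (a * √3 * k 1 + (2 * n₁ - n₀))) * e₁' +
    (-(4 * (q.num : ℝ) * a ^ 2 * k 1 ^ 2)) * h3 +
    (3 * (q.den : ℝ) * (2 * h * k 2 + n₂)) * e₂ - (12 * (q.den : ℝ) * k 2 ^ 2) * hq -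
    (12 * a ^ 2 * k 2 ^ 2) * hqn

/-- `q > 0` when `h² = q a²` with `a, h ≠ 0`; hence `num(q).toNat = num(q)`. [folklore] -/
theorem num_toNat_cast {a h : ℝ} (ha : a ≠ 0) (hh : h ≠ 0) {q : ℚ} (hq : h ^ 2 = (q : ℝ) * a ^ 2) :
    ((q.num.toNat : ℕ) : ℝ) = (q.num : ℝ) := by
  have hq0 : (0 : ℝ) < q := by
    have h1 : 0 < h ^ 2 := by positivity
    have h2 : 0 < a ^ 2 := by positivity
    rw [hq] at h1
    exact pos_of_mul_pos_left h1 h2.le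
  have hnum : 0 ≤ q.num := (Rat.num_pos.2 (by exact_mod_cast hq0)).le
  have : ((q.num.toNat : ℕ) : ℤ) = q.num := Int.toNat_of_nonneg hnum
  calc ((q.num.toNat : ℕ) : ℝ) = (((q.num.toNat : ℕ) : ℤ) : ℝ) := (Int.cast_natCast _).symm
    _ = (q.num : ℝ) := by rw [this]

/-! ## The arithmetic lemma -/

/-- Squared norms on the Bragg set are `a²/(12 num q)`-integral: if `η = 0` or `|η| = |k|` for a
dual vector `k`, then `12 num(q) a² |η|² ∈ ℤ`. [folklore] -/
theorem exists_int_norm_sq_of_not_admissible {a h : ℝ} (ha : a ≠ 0) (hh : h ≠ 0) {q : ℚ}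
    (hq : h ^ 2 = (q : ℝ) * a ^ 2) {η : EuclideanSpace ℝ (Fin 3)}
    (hη : ¬ (η ≠ 0 ∧ ∀ k : EuclideanSpace ℝ (Fin 3),
      (∀ g ∈ (hcpPeriodicConfiguration ha hh).lattice, ∃ n : ℤ, ⟪k, g⟫ = (n : ℝ)) → ‖η‖ ≠ ‖k‖)) :
    ∃ n : ℤ, 12 * (q.num : ℝ) * a ^ 2 * ‖η‖ ^ 2 = (n : ℝ) := by
  by_cases h0 : η = 0
  · exact ⟨0, by rw [h0, norm_zero]; simp⟩
  · simp only [not_and, not_forall, not_not, exists_prop] at hη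
    obtain ⟨k, hk, hηk⟩ := hη h0
    rw [hηk]
    exact hcp_dual_norm_sq ha hh hq hk

/-- **The arithmetic lemma.** Let `h² = q a²`, and let `M` be a `ℤ`-module of vectors with
`D⟨u, v⟩ ∈ a² ℤ` for `u, v ∈ M`. If `ξ + (D/a²) b` lies in the Bragg set
`{0} ∪ ⋃_{k ∈ L*} {|η| = |k|}` for every `b ∈ M`, then `2 D (12 num q) ⟨ξ, z⟩ ∈ ℤ` for every
`z ∈ M`. [folklore] -/
theorem exists_int_of_forall_not_admissible {a h : ℝ} (ha : a ≠ 0) (hh : h ≠ 0) {q : ℚ}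
    (hq : h ^ 2 = (q : ℝ) * a ^ 2) {M : Submodule ℤ (EuclideanSpace ℝ (Fin 3))} {D : ℕ}
    (hMD : ∀ u ∈ M, ∀ v ∈ M, ∃ n : ℤ, (D : ℝ) * ⟪u, v⟫ = (n : ℝ) * a ^ 2)
    {ξ : EuclideanSpace ℝ (Fin 3)}
    (hξ : ∀ b ∈ M, ¬ (ξ + ((D : ℝ) / a ^ 2) • b ≠ 0 ∧ ∀ k : EuclideanSpace ℝ (Fin 3),
      (∀ g ∈ (hcpPeriodicConfiguration ha hh).lattice, ∃ n : ℤ, ⟪k, g⟫ = (n : ℝ)) →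
        ‖ξ + ((D : ℝ) / a ^ 2) • b‖ ≠ ‖k‖))
    {z : EuclideanSpace ℝ (Fin 3)} (hz : z ∈ M) :
    ∃ n : ℤ, ((2 * D * (12 * q.num.toNat) : ℕ) : ℝ) * ⟪ξ, z⟫ = (n : ℝ) := by
  obtain ⟨n₁, hn₁⟩ := exists_int_norm_sq_of_not_admissible ha hh hq (hξ z hz)
  obtain ⟨n₀, hn₀⟩ := exists_int_norm_sq_of_not_admissible ha hh hq (hξ 0 M.zero_mem)
  obtain ⟨nz, hnz⟩ := hMD z hz z hz
  rw [smul_zero, add_zero] at hn₀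
  rw [real_inner_self_eq_norm_sq] at hnz
  have ha2 : a ^ 2 ≠ 0 := pow_ne_zero 2 ha
  have hexp : ‖ξ + ((D : ℝ) / a ^ 2) • z‖ ^ 2 =
      ‖ξ‖ ^ 2 + 2 * ((D : ℝ) / a ^ 2 * ⟪ξ, z⟫) + ((D : ℝ) / a ^ 2) ^ 2 * ‖z‖ ^ 2 := by
    rw [norm_add_sq_real, real_inner_smul_right, norm_smul, mul_pow, Real.norm_eq_abs, sq_abs]
  rw [hexp] at hn₁
  field_simp at hn₁
  have key : a ^ 2 * (((2 * D * (12 * q.num.toNat) : ℕ) : ℝ) * ⟪ξ, z⟫) =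
      a ^ 2 * ((n₁ - n₀ - 12 * q.num * D * nz : ℤ) : ℝ) := by
    push_cast
    rw [num_toNat_cast ha hh hq]
    linear_combination hn₁ - a ^ 2 * hn₀ - (12 * (q.num : ℝ) * (D : ℝ)) * hnz
  exact ⟨_, mul_left_cancel₀ ha2 key⟩

end HcpRigiditySpectral

/-- **Registered helper stub of `stub_essentialPeriodicityRat` (Aux file 4): the arithmetic
lemma.** For the hcp template with `h² = q a²` and a `ℤ`-module `M` with `D⟨u,v⟩ ∈ a²ℤ`
(`u, v ∈ M`, `D ≥ 1`): if `ξ + (D/a²) b` lies in the Bragg set `{0} ∪ ⋃_{k ∈ L*} {|η| = |k|}` for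
every `b ∈ M`, then `2 D (12 num q) ⟨ξ, z⟩ ∈ ℤ` for every `z ∈ M`. [folklore] -/
theorem stub_essentialPeriodicityRatArith : ∀ (a h : ℝ) (ha : a ≠ 0) (hh : h ≠ 0) (q : ℚ), h ^ 2 = (q : ℝ) * a ^ 2 → ∀ (M : Submodule ℤ (EuclideanSpace ℝ (Fin 3))) (D : ℕ), 0 < D → (∀ u ∈ M, ∀ v ∈ M, ∃ n : ℤ, (D : ℝ) * inner ℝ u v = (n : ℝ) * a ^ 2) → ∀ ξ : EuclideanSpace ℝ (Fin 3), (∀ b ∈ M, ¬ (ξ + ((D : ℝ) / a ^ 2) • b ≠ 0 ∧ ∀ k : EuclideanSpace ℝ (Fin 3), (∀ g ∈ (Literature.MathematicalPhysics.StatisticalMechanics.hcpPeriodicConfiguration ha hh).lattice, ∃ n : ℤ, inner ℝ k g = (n : ℝ)) → ‖ξ + ((D : ℝ) / a ^ 2) • b‖ ≠ ‖k‖)) → ∀ z ∈ M, ∃ n : ℤ, ((2 * D * (12 * q.num.toNat) : ℕ) : ℝ) * inner ℝ ξ z = (n : ℝ) :=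
  fun _ _ ha hh _ hq _ _ _ hMD _ hξ _ hz =>
    HcpRigiditySpectral.exists_int_of_forall_not_admissible ha hh hq hMD hξ hz

end Summit.AtomisticToContinuum.Crystallization.Theorems

end
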